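import Mathlib.Algebra.BigOperators.Ring.Finset
import Mathlib.Algebra.Order.BigOperators.Group.Finset
import Mathlib.Analysis.SpecialFunctions.Pow.Real
import Literature.MathematicalPhysics.QuantumFieldTheory.TorusChartFlatCochains
import Literature.MathematicalPhysics.QuantumFieldTheory.TorusChartCurlBound
import HarnessLib

/-!
# Discrete Hodge calculus on charted tori: codifferentials, the lattice Laplacian, `dδ + δd = −Δ`

Discrete exterior calculus on a charted torus (`TorusChart.lean`, `TorusChartCochains.lean`) continued: the
adjoints of the coboundaries `d₀`, `d₁` and the Hodge (Weitzenböck) identity in degree one, which on the cubic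
torus has NO curvature term — the Hodge Laplacian of a `1`-cochain is the scalar lattice Laplacian acting
componentwise.  This is the algebra behind the spin-wave / vortex (Coulomb-gauge) decomposition of bond fields
`a = d₀ φ + β + h` with `β` coclosed and determined by the vortex current `d₁ a`, used by every Villain /
Fröhlich–Spencer unfolding of an abelian lattice model.

* `TorusChart.δ₁ ω x = Σ_i (ω (x − e_i, i) − ω (x, i))` — the codifferential of a `1`-cochain (minus the lattice
  divergence); `TorusChart.δ₂ q (x, i) = Σ_j (q (x; i, j) − q (x − e_j; i, j))` — the codifferential of an
  (alternating) `2`-cochain; `TorusChart.negLap f x = Σ_i ((f x − f (x + e_i)) + (f x − f (x − e_i)))` — the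
  positive lattice Laplacian `−Δ`, and its componentwise versions `negLap₁`, `negLap₂`;
* `δ₁_d₀ : δ₁ (d₀ f) = −Δ f`;  **`d₀_δ₁_add_δ₂_d₁ : d₀ (δ₁ ω) + δ₂ (d₁ ω) = −Δ ω`** (componentwise);
  `δ₁_δ₂_of_alternating : δ₁ (δ₂ q) = 0`; additivity; the operators commute with translations
  (`d₀_translate`, …) and with the Laplacians (`negLap₁_d₀`, `negLap_δ₁`, `negLap₂_d₁`, `negLap₁_δ₂`);
* on a finite torus with coefficients in a commutative ring: `sum_δ₁ : Σ_x δ₁ ω = 0`, `sum_negLap`, `sum_d₀`,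
  `sum_δ₂`, the adjointness identities `sum_d₀_mul : ⟨d₀ f, ω⟩ = ⟨f, δ₁ ω⟩` and
  `sum_d₁_mul_of_alternating : ⟨d₁ ω, q⟩ = 2⟨ω, δ₂ q⟩` (ordered pairs `(i, j)`, alternating `q`), and the
  Dirichlet form `sum_mul_negLap : ⟨f, −Δ g⟩ = ⟨d₀ f, d₀ g⟩`;
* over `ℝ`: `−Δ ≥ 0` (`sum_mul_negLap_self_nonneg`) and **`negLap_eq_zero_iff`**: `−Δ f = 0 ↔ f` is constant
  (the torus is connected by unit steps, `d₀_eq_zero_iff`); componentwise `negLap₁_eq_zero_iff`.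

## References
* B. Eckmann, Harmonische Funktionen und Randwertaufgaben in einem Komplex, Comment. Math. Helv. 17 (1945) 240–255.
* J. Fröhlich, T. Spencer, Comm. Math. Phys. 83 (1982) 411–454, §2.3. [FrohlichSpencerCMP1982]
-/

namespace Literature.MathematicalPhysics.QuantumFieldTheory

open scoped BigOperators

namespace TorusChart

variable {Λ : Type*} [AddCommGroup Λ] {d : ℕ} (F : TorusChart Λ d)

/-! ## Codifferentials and the lattice Laplacian -/

section Algebra

variable {A : Type*} [AddCommGroup A]

/-- The **codifferential of a `1`-cochain** (minus the lattice divergence):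
`δ₁ ω x = Σ_i (ω (x − e_i, i) − ω (x, i))`, the adjoint of `d₀`. [folklore] -/
def δ₁ (ω : Λ → Fin d → A) : Λ → A := fun x => ∑ i, (ω (x - F.gen i) i - ω x i)

/-- The **codifferential of a `2`-cochain**: `δ₂ q (x, i) = Σ_j (q (x; i, j) − q (x − e_j; i, j))`; for
alternating `q` it is the adjoint of `d₁` for the pairing over unordered plaquettes. [folklore] -/
def δ₂ (q : Λ → Fin d → Fin d → A) : Λ → Fin d → A := fun x i => ∑ j, (q x i j - q (x - F.gen j) i j)

/-- The **positive lattice Laplacian** `−Δ f (x) = Σ_i ((f x − f (x + e_i)) + (f x − f (x − e_i)))`.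
[folklore] -/
def negLap (f : Λ → A) : Λ → A := fun x => ∑ i, ((f x - f (x + F.gen i)) + (f x - f (x - F.gen i)))

/-- The lattice Laplacian acting componentwise on `1`-cochains. [folklore] -/
def negLap₁ (ω : Λ → Fin d → A) : Λ → Fin d → A := fun x i => F.negLap (fun y => ω y i) x

/-- The lattice Laplacian acting componentwise on `2`-cochains. [folklore] -/
def negLap₂ (q : Λ → Fin d → Fin d → A) : Λ → Fin d → Fin d → A := fun x i j => F.negLap (fun y => q y i j) x

/-- Unfolding `δ₁`. [folklore] -/
@[simp] theorem δ₁_apply (ω : Λ → Fin d → A) (x : Λ) : F.δ₁ ω x = ∑ i, (ω (x - F.gen i) i - ω x i) := rfl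

/-- Unfolding `δ₂`. [folklore] -/
@[simp] theorem δ₂_apply (q : Λ → Fin d → Fin d → A) (x : Λ) (i : Fin d) :
    F.δ₂ q x i = ∑ j, (q x i j - q (x - F.gen j) i j) := rfl

/-- Unfolding `negLap`. [folklore] -/
@[simp] theorem negLap_apply (f : Λ → A) (x : Λ) :
    F.negLap f x = ∑ i, ((f x - f (x + F.gen i)) + (f x - f (x - F.gen i))) := rfl

/-- Unfolding `negLap₁`. [folklore] -/
@[simp] theorem negLap₁_apply (ω : Λ → Fin d → A) (x : Λ) (i : Fin d) :
    F.negLap₁ ω x i = F.negLap (fun y => ω y i) x := rfl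

/-- Unfolding `negLap₂`. [folklore] -/
@[simp] theorem negLap₂_apply (q : Λ → Fin d → Fin d → A) (x : Λ) (i j : Fin d) :
    F.negLap₂ q x i j = F.negLap (fun y => q y i j) x := rfl

/-- **`δ₁ ∘ d₀ = −Δ`.** [folklore] -/
theorem δ₁_d₀ (f : Λ → A) : F.δ₁ (F.d₀ f) = F.negLap f := by
  funext x
  simp only [δ₁_apply, d₀_apply, negLap_apply, sub_add_cancel]
  refine Finset.sum_congr rfl fun i _ => ?_
  abel

/-- **The Hodge identity in degree one**: `d₀ (δ₁ ω) + δ₂ (d₁ ω) = −Δ ω` componentwise — on the cubic torus the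
Hodge Laplacian of a `1`-cochain has no curvature term. [folklore] -/
theorem d₀_δ₁_add_δ₂_d₁ (ω : Λ → Fin d → A) : F.d₀ (F.δ₁ ω) + F.δ₂ (F.d₁ ω) = F.negLap₁ ω := by
  funext x i
  simp only [Pi.add_apply, d₀_apply, δ₁_apply, δ₂_apply, d₁_apply, negLap₁_apply, negLap_apply,
    ← Finset.sum_sub_distrib, ← Finset.sum_add_distrib, sub_add_cancel]
  refine Finset.sum_congr rfl fun j _ => ?_
  rw [add_sub_right_comm x (F.gen i) (F.gen j), sub_add_eq_add_sub x (F.gen j) (F.gen i)]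
  abel

/-- The Hodge identity solved for the coexact term: `δ₂ (d₁ ω) = −Δ ω − d₀ (δ₁ ω)`. [folklore] -/
theorem δ₂_d₁_eq (ω : Λ → Fin d → A) : F.δ₂ (F.d₁ ω) = F.negLap₁ ω - F.d₀ (F.δ₁ ω) := by
  rw [← F.d₀_δ₁_add_δ₂_d₁ ω, add_sub_cancel_left]

/-- A double sum of an alternating array vanishes (in any abelian group). [folklore] -/
theorem sum_sum_eq_zero_of_alternating (g : Fin d → Fin d → A) (h0 : ∀ i, g i i = 0)
    (hs : ∀ i j, g j i = -g i j) : ∑ i, ∑ j, g i j = 0 := by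
  rw [← Fintype.sum_prod_type']
  refine Finset.sum_involution (fun p _ => (p.2, p.1)) (fun p _ => ?_) (fun p _ hp => ?_) (fun p _ => ?_)
    (fun p _ => ?_)
  · rw [hs p.1 p.2, add_neg_cancel]
  · intro h
    apply hp
    have h12 : p.1 = p.2 := congrArg Prod.snd h
    show g p.1 p.2 = 0
    rw [h12, h0]
  · exact Finset.mem_univ _
  · rfl

/-- `δ₁ ∘ δ₂ = 0` on alternating `2`-cochains. [folklore] -/
theorem δ₁_δ₂_of_alternating (q : Λ → Fin d → Fin d → A) (h0 : ∀ x i, q x i i = 0)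
    (hs : ∀ x i j, q x j i = -q x i j) : F.δ₁ (F.δ₂ q) = 0 := by
  funext x
  simp only [δ₁_apply, δ₂_apply, Pi.zero_apply, ← Finset.sum_sub_distrib]
  have e1 : ∀ i j : Fin d, q (x - F.gen i) i j - q (x - F.gen i - F.gen j) i j - (q x i j - q (x - F.gen j) i j)
      = (q (x - F.gen i) i j + q (x - F.gen j) i j) - q (x - F.gen i - F.gen j) i j - q x i j := fun i j => by
    abel
  simp only [e1, Finset.sum_sub_distrib, Finset.sum_add_distrib]
  have hA : ∑ i, ∑ j, q (x - F.gen i) i j + ∑ i, ∑ j, q (x - F.gen j) i j = 0 := by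
    rw [Finset.sum_comm (f := fun i j => q (x - F.gen j) i j), ← Finset.sum_add_distrib]
    refine Finset.sum_eq_zero fun i _ => ?_
    rw [← Finset.sum_add_distrib]
    exact Finset.sum_eq_zero fun j _ => by rw [hs, neg_add_cancel]
  have hB : ∑ i, ∑ j, q (x - F.gen i - F.gen j) i j = 0 :=
    sum_sum_eq_zero_of_alternating _ (fun i => h0 _ i) fun i j => by rw [sub_right_comm, hs]
  have hC : ∑ i, ∑ j, q x i j = 0 := sum_sum_eq_zero_of_alternating _ (h0 x) (hs x)
  rw [hA, hB, hC, sub_zero, sub_zero]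

/-- `δ₁ (δ₂ (d₁ ω)) = 0`. [folklore] -/
theorem δ₁_δ₂_d₁ (ω : Λ → Fin d → A) : F.δ₁ (F.δ₂ (F.d₁ ω)) = 0 :=
  F.δ₁_δ₂_of_alternating _ (fun x i => F.d₁_self ω x i) fun x i j => F.d₁_swap ω x i j

/-! ### Additivity -/

/-- `δ₁` is additive. [folklore] -/
theorem δ₁_add (ω η : Λ → Fin d → A) : F.δ₁ (ω + η) = F.δ₁ ω + F.δ₁ η := by
  funext x; simp only [δ₁_apply, Pi.add_apply, ← Finset.sum_add_distrib]
  exact Finset.sum_congr rfl fun i _ => by abel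

/-- `δ₁` commutes with negation. [folklore] -/
theorem δ₁_neg (ω : Λ → Fin d → A) : F.δ₁ (-ω) = -F.δ₁ ω := by
  funext x; simp only [δ₁_apply, Pi.neg_apply, ← Finset.sum_neg_distrib]
  exact Finset.sum_congr rfl fun i _ => by abel

/-- `δ₁` is subtractive. [folklore] -/
theorem δ₁_sub (ω η : Λ → Fin d → A) : F.δ₁ (ω - η) = F.δ₁ ω - F.δ₁ η := by
  rw [sub_eq_add_neg, δ₁_add, δ₁_neg, ← sub_eq_add_neg]

/-- `δ₁ 0 = 0`. [folklore] -/
@[simp] theorem δ₁_zero : F.δ₁ (0 : Λ → Fin d → A) = 0 := by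
  funext x; simp

/-- Constant `1`-cochains are coclosed. [folklore] -/
@[simp] theorem δ₁_const (c : Fin d → A) : F.δ₁ (fun _ : Λ => c) = 0 := by
  funext x; simp

/-- `δ₂` is additive. [folklore] -/
theorem δ₂_add (q p : Λ → Fin d → Fin d → A) : F.δ₂ (q + p) = F.δ₂ q + F.δ₂ p := by
  funext x i; simp only [δ₂_apply, Pi.add_apply, ← Finset.sum_add_distrib]
  exact Finset.sum_congr rfl fun j _ => by abel

/-- `δ₂` commutes with negation. [folklore] -/
theorem δ₂_neg (q : Λ → Fin d → Fin d → A) : F.δ₂ (-q) = -F.δ₂ q := by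
  funext x i; simp only [δ₂_apply, Pi.neg_apply, ← Finset.sum_neg_distrib]
  exact Finset.sum_congr rfl fun j _ => by abel

/-- `δ₂` is subtractive. [folklore] -/
theorem δ₂_sub (q p : Λ → Fin d → Fin d → A) : F.δ₂ (q - p) = F.δ₂ q - F.δ₂ p := by
  rw [sub_eq_add_neg, δ₂_add, δ₂_neg, ← sub_eq_add_neg]

/-- `δ₂ 0 = 0`. [folklore] -/
@[simp] theorem δ₂_zero : F.δ₂ (0 : Λ → Fin d → Fin d → A) = 0 := by
  funext x i; simp

/-- Constant `2`-cochains have zero codifferential. [folklore] -/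
@[simp] theorem δ₂_const (c : Fin d → Fin d → A) : F.δ₂ (fun _ : Λ => c) = 0 := by
  funext x i; simp

/-- Constant `1`-cochains are closed. [folklore] -/
@[simp] theorem d₁_const (c : Fin d → A) : F.d₁ (fun _ : Λ => c) = 0 := by
  funext x i j; simp only [d₁_apply, Pi.zero_apply]; abel

/-- `−Δ` is additive. [folklore] -/
theorem negLap_add (f g : Λ → A) : F.negLap (f + g) = F.negLap f + F.negLap g := by
  funext x; simp only [negLap_apply, Pi.add_apply, ← Finset.sum_add_distrib]
  exact Finset.sum_congr rfl fun i _ => by abel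

/-- `−Δ` commutes with negation. [folklore] -/
theorem negLap_neg (f : Λ → A) : F.negLap (-f) = -F.negLap f := by
  funext x; simp only [negLap_apply, Pi.neg_apply, ← Finset.sum_neg_distrib]
  exact Finset.sum_congr rfl fun i _ => by abel

/-- `−Δ` is subtractive. [folklore] -/
theorem negLap_sub (f g : Λ → A) : F.negLap (f - g) = F.negLap f - F.negLap g := by
  rw [sub_eq_add_neg, negLap_add, negLap_neg, ← sub_eq_add_neg]

/-- `−Δ 0 = 0`. [folklore] -/
@[simp] theorem negLap_zero : F.negLap (0 : Λ → A) = 0 := by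
  funext x; simp

/-- Constants are harmonic. [folklore] -/
@[simp] theorem negLap_const (a : A) : F.negLap (fun _ : Λ => a) = 0 := by
  funext x; simp

/-- `−Δ` commutes with integer scalar multiplication. [folklore] -/
theorem negLap_zsmul (n : ℤ) (f : Λ → A) : F.negLap (n • f) = n • F.negLap f := by
  funext x; simp only [negLap_apply, Pi.smul_apply, Finset.smul_sum, smul_add, smul_sub]

/-- `−Δ` on `1`-cochains is additive. [folklore] -/
theorem negLap₁_add (ω η : Λ → Fin d → A) : F.negLap₁ (ω + η) = F.negLap₁ ω + F.negLap₁ η := by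
  funext x i; simp only [negLap₁_apply, Pi.add_apply]
  exact congr_fun (F.negLap_add (fun y => ω y i) (fun y => η y i)) x

/-- `−Δ` on `1`-cochains is subtractive. [folklore] -/
theorem negLap₁_sub (ω η : Λ → Fin d → A) : F.negLap₁ (ω - η) = F.negLap₁ ω - F.negLap₁ η := by
  funext x i; simp only [negLap₁_apply, Pi.sub_apply]
  exact congr_fun (F.negLap_sub (fun y => ω y i) (fun y => η y i)) x

/-- `−Δ 0 = 0` on `1`-cochains. [folklore] -/
@[simp] theorem negLap₁_zero : F.negLap₁ (0 : Λ → Fin d → A) = 0 := by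
  funext x i; simp

/-- Constant `1`-cochains are harmonic. [folklore] -/
@[simp] theorem negLap₁_const (c : Fin d → A) : F.negLap₁ (fun _ : Λ => c) = 0 := by
  funext x i; simp

/-- `−Δ` on `2`-cochains is additive. [folklore] -/
theorem negLap₂_add (q p : Λ → Fin d → Fin d → A) : F.negLap₂ (q + p) = F.negLap₂ q + F.negLap₂ p := by
  funext x i j; simp only [negLap₂_apply, Pi.add_apply]
  exact congr_fun (F.negLap_add (fun y => q y i j) (fun y => p y i j)) x

/-- `−Δ` on `2`-cochains is subtractive. [folklore] -/
theorem negLap₂_sub (q p : Λ → Fin d → Fin d → A) : F.negLap₂ (q - p) = F.negLap₂ q - F.negLap₂ p := by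
  funext x i j; simp only [negLap₂_apply, Pi.sub_apply]
  exact congr_fun (F.negLap_sub (fun y => q y i j) (fun y => p y i j)) x

/-! ### Translation covariance and commutation with the Laplacian -/

/-- `d₀` commutes with translations. [folklore] -/
theorem d₀_translate (f : Λ → A) (v : Λ) : F.d₀ (fun x => f (x + v)) = fun x i => F.d₀ f (x + v) i := by
  funext x i; simp only [d₀_apply, add_right_comm x (F.gen i) v]

/-- `d₁` commutes with translations. [folklore] -/
theorem d₁_translate (ω : Λ → Fin d → A) (v : Λ) :
    F.d₁ (fun x i => ω (x + v) i) = fun x i j => F.d₁ ω (x + v) i j := by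
  funext x i j; simp only [d₁_apply, add_right_comm x _ v]

/-- `δ₁` commutes with translations. [folklore] -/
theorem δ₁_translate (ω : Λ → Fin d → A) (v : Λ) :
    F.δ₁ (fun x i => ω (x + v) i) = fun x => F.δ₁ ω (x + v) := by
  funext x; simp only [δ₁_apply, sub_add_eq_add_sub]

/-- `δ₂` commutes with translations. [folklore] -/
theorem δ₂_translate (q : Λ → Fin d → Fin d → A) (v : Λ) :
    F.δ₂ (fun x i j => q (x + v) i j) = fun x i => F.δ₂ q (x + v) i := by
  funext x i; simp only [δ₂_apply, sub_add_eq_add_sub]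

/-- `−Δ` commutes with translations. [folklore] -/
theorem negLap_translate (f : Λ → A) (v : Λ) :
    F.negLap (fun x => f (x + v)) = fun x => F.negLap f (x + v) := by
  funext x; simp only [negLap_apply, add_right_comm x _ v, sub_add_eq_add_sub]

/-- `−Δ` commutes with `d₀`: `−Δ (d₀ f) = d₀ (−Δ f)` (componentwise Laplacian on the left). [folklore] -/
theorem negLap₁_d₀ (f : Λ → A) : F.negLap₁ (F.d₀ f) = F.d₀ (F.negLap f) := by
  funext x i
  simp only [negLap₁_apply, negLap_apply, d₀_apply, add_right_comm x (F.gen i), sub_add_eq_add_sub x _ (F.gen i)]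
  rw [← Finset.sum_sub_distrib]
  exact Finset.sum_congr rfl fun j _ => by abel

/-- `−Δ` commutes with `δ₁`: `−Δ (δ₁ ω) = δ₁ (−Δ ω)` (from `δ₁ d₀ = −Δ`, the Hodge identity and `δ₁ δ₂ d₁ = 0`).
[folklore] -/
theorem negLap_δ₁ (ω : Λ → Fin d → A) : F.negLap (F.δ₁ ω) = F.δ₁ (F.negLap₁ ω) := by
  rw [← δ₁_d₀, show F.d₀ (F.δ₁ ω) = F.negLap₁ ω - F.δ₂ (F.d₁ ω) from eq_sub_of_add_eq (F.d₀_δ₁_add_δ₂_d₁ ω),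
    δ₁_sub, δ₁_δ₂_d₁, sub_zero]

/-- `−Δ` commutes with `d₁`: `−Δ (d₁ ω) = d₁ (−Δ ω)`. [folklore] -/
theorem negLap₂_d₁ (ω : Λ → Fin d → A) : F.negLap₂ (F.d₁ ω) = F.d₁ (F.negLap₁ ω) := by
  funext x i j
  simp only [negLap₂_apply, negLap₁_apply, negLap_apply, d₁_apply]
  rw [← Finset.sum_add_distrib, ← Finset.sum_sub_distrib, ← Finset.sum_sub_distrib]
  refine Finset.sum_congr rfl fun k _ => ?_
  rw [add_right_comm x (F.gen k) (F.gen i), add_right_comm x (F.gen k) (F.gen j),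
    sub_add_eq_add_sub x (F.gen k) (F.gen i), sub_add_eq_add_sub x (F.gen k) (F.gen j)]
  abel

/-- `−Δ` commutes with `δ₂`: `−Δ (δ₂ q) = δ₂ (−Δ q)`. [folklore] -/
theorem negLap₁_δ₂ (q : Λ → Fin d → Fin d → A) : F.negLap₁ (F.δ₂ q) = F.δ₂ (F.negLap₂ q) := by
  funext x i
  simp only [negLap₁_apply, negLap₂_apply, negLap_apply, δ₂_apply]
  simp only [← Finset.sum_sub_distrib, ← Finset.sum_add_distrib]
  rw [Finset.sum_comm]
  refine Finset.sum_congr rfl fun j _ => Finset.sum_congr rfl fun k _ => ?_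
  rw [sub_add_eq_add_sub x (F.gen j) (F.gen k), sub_right_comm x (F.gen j) (F.gen k)]
  abel

end Algebra

/-! ## Sums over a finite torus: vanishing totals and adjointness -/

section Sums

variable [Fintype Λ] {R : Type*} [CommRing R]

/-- A sum over the torus is invariant under translation of the summation variable by `−v`. [folklore] -/
theorem sum_comp_sub_eq {M : Type*} [AddCommMonoid M] (g : Λ → M) (v : Λ) : ∑ x, g (x - v) = ∑ x, g x :=
  Fintype.sum_equiv (Equiv.subRight v) _ _ fun _ => rfl

/-- Codifferentials have zero total: `Σ_x δ₁ ω x = 0`. [folklore] -/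
theorem sum_δ₁ {A : Type*} [AddCommGroup A] (ω : Λ → Fin d → A) : ∑ x, F.δ₁ ω x = 0 := by
  simp only [δ₁_apply]
  rw [Finset.sum_comm]
  exact Finset.sum_eq_zero fun i _ => by
    rw [Finset.sum_sub_distrib, sum_comp_sub_eq (fun x => ω x i) (F.gen i), sub_self]

/-- The Laplacian has zero total: `Σ_x (−Δ f) x = 0`. [folklore] -/
theorem sum_negLap {A : Type*} [AddCommGroup A] (f : Λ → A) : ∑ x, F.negLap f x = 0 := by
  rw [← δ₁_d₀, sum_δ₁]

/-- Gradients have zero total in every direction: `Σ_x d₀ f x i = 0`. [folklore] -/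
theorem sum_d₀ {A : Type*} [AddCommGroup A] (f : Λ → A) (i : Fin d) : ∑ x, F.d₀ f x i = 0 := by
  simp only [d₀_apply, Finset.sum_sub_distrib, sum_comp_add_eq (fun x => f x) (F.gen i), sub_self]

/-- `δ₂ q` has zero total in every direction. [folklore] -/
theorem sum_δ₂ {A : Type*} [AddCommGroup A] (q : Λ → Fin d → Fin d → A) (i : Fin d) :
    ∑ x, F.δ₂ q x i = 0 := by
  simp only [δ₂_apply]
  rw [Finset.sum_comm]
  exact Finset.sum_eq_zero fun j _ => by
    rw [Finset.sum_sub_distrib, sum_comp_sub_eq (fun x => q x i j) (F.gen j), sub_self]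

/-- The componentwise Laplacian of a `1`-cochain has zero total in every direction. [folklore] -/
theorem sum_negLap₁ {A : Type*} [AddCommGroup A] (ω : Λ → Fin d → A) (i : Fin d) :
    ∑ x, F.negLap₁ ω x i = 0 := by
  simp only [negLap₁_apply]
  exact F.sum_negLap fun y => ω y i

/-- **Adjointness of `d₀` and `δ₁`**: `Σ_{x,i} d₀ f (x,i) · ω (x,i) = Σ_x f x · δ₁ ω x`. [folklore] -/
theorem sum_d₀_mul (f : Λ → R) (ω : Λ → Fin d → R) :
    ∑ x, ∑ i, F.d₀ f x i * ω x i = ∑ x, f x * F.δ₁ ω x := by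
  simp only [d₀_apply, δ₁_apply, sub_mul, Finset.sum_sub_distrib, Finset.mul_sum, mul_sub]
  rw [Finset.sum_comm (f := fun x i => f (x + F.gen i) * ω x i), Finset.sum_comm (f := fun x i => f x * ω x i),
    Finset.sum_comm (f := fun x i => f x * ω (x - F.gen i) i), ← Finset.sum_sub_distrib, ← Finset.sum_sub_distrib]
  refine Finset.sum_congr rfl fun i _ => ?_
  rw [← sum_comp_sub_eq (fun x => f (x + F.gen i) * ω x i) (F.gen i)]
  simp only [sub_add_cancel]

/-- **Adjointness of `d₁` and `δ₂`** (general `2`-cochains):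
`Σ_{x,i,j} d₁ ω (x;i,j) · q (x;i,j) = Σ_{x,i} ω (x,i) · (δ₂ q (x,i) − δ₂ qᵀ (x,i))`, `qᵀ (x;i,j) = q (x;j,i)`.
[folklore] -/
theorem sum_d₁_mul (ω : Λ → Fin d → R) (q : Λ → Fin d → Fin d → R) :
    ∑ x, ∑ i, ∑ j, F.d₁ ω x i j * q x i j
      = ∑ x, ∑ i, ω x i * (F.δ₂ q x i - F.δ₂ (fun y i j => q y j i) x i) := by
  -- expand both sides into four families of triple sums and match them after reindexing
  have hL : ∑ x, ∑ i, ∑ j, F.d₁ ω x i j * q x i j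
      = ∑ x, ∑ i, ∑ j, ω x i * q x i j + ∑ x, ∑ i, ∑ j, ω (x + F.gen i) j * q x i j
        - ∑ x, ∑ i, ∑ j, ω (x + F.gen j) i * q x i j - ∑ x, ∑ i, ∑ j, ω x j * q x i j := by
    simp only [d₁_apply, add_mul, sub_mul, Finset.sum_add_distrib, Finset.sum_sub_distrib]
  have hR : ∑ x, ∑ i, ω x i * (F.δ₂ q x i - F.δ₂ (fun y i j => q y j i) x i)
      = ∑ x, ∑ i, ∑ j, ω x i * q x i j - ∑ x, ∑ i, ∑ j, ω x i * q (x - F.gen j) i j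
        - (∑ x, ∑ i, ∑ j, ω x i * q x j i - ∑ x, ∑ i, ∑ j, ω x i * q (x - F.gen j) j i) := by
    simp only [δ₂_apply, mul_sub, Finset.mul_sum, Finset.sum_sub_distrib]
  rw [hL, hR]
  have hsw : ∀ g : Λ → Fin d → Fin d → R, ∑ x, ∑ i, ∑ j, g x i j = ∑ i, ∑ j, ∑ x, g x i j := fun g => by
    rw [Finset.sum_comm]; exact Finset.sum_congr rfl fun i _ => Finset.sum_comm
  -- second family: shift `x ↦ x − e_i` and swap the direction indices
  have h2 : ∑ x, ∑ i, ∑ j, ω (x + F.gen i) j * q x i j = ∑ x, ∑ i, ∑ j, ω x i * q (x - F.gen j) j i := by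
    rw [hsw (fun x i j => ω (x + F.gen i) j * q x i j), hsw (fun x i j => ω x i * q (x - F.gen j) j i),
      Finset.sum_comm (f := fun i j => ∑ x, ω x i * q (x - F.gen j) j i)]
    refine Finset.sum_congr rfl fun i _ => Finset.sum_congr rfl fun j _ => ?_
    rw [← sum_comp_sub_eq (fun x => ω (x + F.gen i) j * q x i j) (F.gen i)]
    simp only [sub_add_cancel]
  -- third family: shift `x ↦ x − e_j`
  have h3 : ∑ x, ∑ i, ∑ j, ω (x + F.gen j) i * q x i j = ∑ x, ∑ i, ∑ j, ω x i * q (x - F.gen j) i j := by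
    rw [hsw (fun x i j => ω (x + F.gen j) i * q x i j), hsw (fun x i j => ω x i * q (x - F.gen j) i j)]
    refine Finset.sum_congr rfl fun i _ => Finset.sum_congr rfl fun j _ => ?_
    rw [← sum_comp_sub_eq (fun x => ω (x + F.gen j) i * q x i j) (F.gen j)]
    simp only [sub_add_cancel]
  -- fourth family: swap the direction indices
  have h4 : ∑ x, ∑ i, ∑ j, ω x j * q x i j = ∑ x, ∑ i, ∑ j, ω x i * q x j i :=
    Finset.sum_congr rfl fun x _ => Finset.sum_comm
  rw [h2, h3, h4]
  abel

/-- **Adjointness of `d₁` and `δ₂` for alternating `2`-cochains**: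
`Σ_{x,i,j} d₁ ω (x;i,j) · q (x;i,j) = 2 Σ_{x,i} ω (x,i) · δ₂ q (x,i)` (the factor `2` because ordered pairs
`(i,j)` count every plaquette twice). [folklore] -/
theorem sum_d₁_mul_of_alternating (ω : Λ → Fin d → R) (q : Λ → Fin d → Fin d → R)
    (hs : ∀ x i j, q x j i = -q x i j) :
    ∑ x, ∑ i, ∑ j, F.d₁ ω x i j * q x i j = 2 * ∑ x, ∑ i, ω x i * F.δ₂ q x i := by
  rw [sum_d₁_mul]
  have hT : (fun y i j => q y j i) = -q := by
    funext y i j; exact hs y i j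
  rw [hT, δ₂_neg, two_mul, ← Finset.sum_add_distrib]
  refine Finset.sum_congr rfl fun x _ => ?_
  rw [← Finset.sum_add_distrib]
  exact Finset.sum_congr rfl fun i _ => by simp only [Pi.neg_apply, sub_neg_eq_add, mul_add]

/-- **The Dirichlet form**: `Σ_x f x · (−Δ g) x = Σ_{x,i} d₀ f (x,i) · d₀ g (x,i)`. [folklore] -/
theorem sum_mul_negLap (f g : Λ → R) : ∑ x, f x * F.negLap g x = ∑ x, ∑ i, F.d₀ f x i * F.d₀ g x i := by
  rw [← δ₁_d₀, ← sum_d₀_mul]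

/-- `−Δ` is symmetric. [folklore] -/
theorem sum_mul_negLap_comm (f g : Λ → R) : ∑ x, f x * F.negLap g x = ∑ x, F.negLap f x * g x := by
  conv_rhs => arg 2; ext x; rw [mul_comm]
  rw [sum_mul_negLap, sum_mul_negLap]
  exact Finset.sum_congr rfl fun x _ => Finset.sum_congr rfl fun i _ => mul_comm _ _

/-- The componentwise Dirichlet form on `1`-cochains. [folklore] -/
theorem sum_sum_mul_negLap₁ (ω η : Λ → Fin d → R) :
    ∑ x, ∑ i, ω x i * F.negLap₁ η x i = ∑ i, ∑ x, ∑ k, F.d₀ (fun y => ω y i) x k * F.d₀ (fun y => η y i) x k := by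
  rw [Finset.sum_comm]
  exact Finset.sum_congr rfl fun i _ => F.sum_mul_negLap (fun y => ω y i) (fun y => η y i)

end Sums

/-! ## Positivity and the kernel of the Laplacian over `ℝ` -/

section Real

variable [Fintype Λ]

/-- `−Δ ≥ 0`: `Σ_x f x · (−Δ f) x = ‖d₀ f‖² ≥ 0`. [folklore] -/
theorem sum_mul_negLap_self_nonneg (f : Λ → ℝ) : 0 ≤ ∑ x, f x * F.negLap f x := by
  rw [sum_mul_negLap]
  exact Finset.sum_nonneg fun x _ => Finset.sum_nonneg fun i _ => mul_self_nonneg _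

/-- **The kernel of the Laplacian is the constants**: `−Δ f = 0 ↔ f` is constant (a harmonic function on the
finite torus has zero Dirichlet energy, hence zero gradient, and the torus is connected by unit steps).
[folklore] -/
theorem negLap_eq_zero_iff (f : Λ → ℝ) : F.negLap f = 0 ↔ ∀ x, f x = f 0 := by
  rw [← F.d₀_eq_zero_iff f]
  constructor
  · intro h
    have hE : ∑ x, ∑ i, F.d₀ f x i * F.d₀ f x i = 0 := by
      rw [← sum_mul_negLap, h]; simp
    funext x i
    have hx := (Finset.sum_eq_zero_iff_of_nonneg fun y _ =>
      Finset.sum_nonneg fun i _ => mul_self_nonneg (F.d₀ f y i)).1 hE x (Finset.mem_univ x)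
    have hxi := (Finset.sum_eq_zero_iff_of_nonneg fun j _ => mul_self_nonneg (F.d₀ f x j)).1 hx i
      (Finset.mem_univ i)
    exact mul_self_eq_zero.1 hxi
  · intro h
    rw [← δ₁_d₀, h, δ₁_zero]

/-- A harmonic function with zero total vanishes. [folklore] -/
theorem eq_zero_of_negLap_eq_zero_of_sum_eq_zero {f : Λ → ℝ} (hf : F.negLap f = 0) (hs : ∑ x, f x = 0) :
    f = 0 := by
  have hc := (F.negLap_eq_zero_iff f).1 hf
  have h0 : f 0 = 0 := by
    have : ∑ x : Λ, f x = Fintype.card Λ • f 0 := by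
      rw [← Finset.card_univ, ← Finset.sum_const]
      exact Finset.sum_congr rfl fun x _ => hc x
    rw [this, nsmul_eq_mul] at hs
    rcases mul_eq_zero.1 hs with h | h
    · exact absurd h (Nat.cast_ne_zero.2 Fintype.card_ne_zero)
    · exact h
  funext x; rw [hc x, h0]; rfl

/-- The kernel of the componentwise Laplacian on `1`-cochains is the constant cochains. [folklore] -/
theorem negLap₁_eq_zero_iff (ω : Λ → Fin d → ℝ) : F.negLap₁ ω = 0 ↔ ∀ x i, ω x i = ω 0 i := by
  constructor
  · intro h x i
    have hi : F.negLap (fun y => ω y i) = 0 := by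
      funext y; exact congr_fun (congr_fun h y) i
    exact (F.negLap_eq_zero_iff _).1 hi x
  · intro h
    funext x i
    have hi : F.negLap (fun y => ω y i) = 0 := (F.negLap_eq_zero_iff _).2 fun y => h y i
    exact congr_fun hi x

end Real

end TorusChart

end Literature.MathematicalPhysics.QuantumFieldTheory
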